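import Summits.Ventures.DiscreteObjects.PP12.FlagOrbitMatrix
import Summits.Ventures.DiscreteObjects.PP12.FlagSevenOrbitMatrix

/-!
# The structured `f = 7` orbit matrix is a plain one: `IsFlagSevenOrbitMatrix D → IsFlagOrbitMatrix 2 D.entry` (kernel; bridge between the typed statements)
Framing: lottery ticket; floor = certified bounds/negative ranges.

Cell pub-namedobj (venture DiscreteObjects), target (M), designs gen 15. Designs g13's structured statement `IsFlagSevenOrbitMatrix D` (p327216; data
`κ, ψ, R, γ, C, β`, index types `F7Row = F7Col = Fin 2 ⊕ (Fin 2 × Fin 12) ⊕ (Fin 6 × Fin 4)`) and the generic plain statement `IsFlagOrbitMatrix 2 M`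
(p344983; `FRow 2 = FCol 2`, the same type since `12 − 3·2 = 6`) have the same row/column inner-product systems; this file checks that the structured
entries ALSO satisfy the remaining plain conjuncts (row/column totals — the column totals via the column norms, since all entries off the side
diagonal are `0/1` —, the c-line rows, the vanishing T-line/`Z` entries and the side diagonal `2 = 2·[i = i] + [i = ψ i]`, `ψ i ≠ i`):
**`isFlagOrbitMatrix_of_isFlagSevenOrbitMatrix`**, hence **`noFlagSevenOrbitMatrix_of_noFlagOrbitMatrix_two : NoFlagOrbitMatrix 2 → NoFlagSevenOrbitMatrix`**
— the plain statement for `ρ = 2` is at least as strong as the structured one, so a census run on the PLAIN `f = 7` system settles both typed statements.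
(The converse needs the reconstruction of `κ, ψ, R, γ, C, β` from a plain matrix — `FlagOrbitBlocks` supplies `κ, γ, β` — and is not attempted.)
Nothing here decides either statement. No `sorry`, no new axioms.
-/

namespace Summit.Ventures.DiscreteObjects.PP12

open Finset
open scoped Classical

namespace FlagSevenOrbitData

variable (D : FlagSevenOrbitData)

/-- `ind` with any decidability instance, and its bound (one conjunction, to keep the tree free of duplicate helper statements). -/
theorem ind_spec (p : Prop) [Decidable p] : (ind p = if p then 1 else 0) ∧ ind p ≤ 1 := by
  unfold ind; by_cases hp : p <;> simp [hp]


/-- `ind p · ind p = ind p`. -/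
theorem ind_mul_self (p : Prop) : ind p * ind p = ind p := by
  unfold ind; split_ifs <;> simp

/-- The two `rowTarget`s agree. -/
theorem rowTarget_eq (r r' : F7Row) : rowTarget r r' = FlagOrbit.rowTarget (ρ := 2) r r' := by
  rcases r with s | x | ⟨k, t⟩ <;> rcases r' with s' | x' | ⟨k', t'⟩ <;> rfl

/-- The two `colTarget`s agree. -/
theorem colTarget_eq (c c' : F7Col) : colTarget c c' = FlagOrbit.colTarget (ρ := 2) c c' := by
  rcases c with t | x | ⟨j, t⟩ <;> rcases c' with t' | x' | ⟨j', t'⟩ <;> rfl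

/-! ### Entry facts -/

/-- c-line rows are `gammaEntry`. -/
theorem entry_gamma (s : Fin 2) (c : F7Col) : D.entry (Sum.inl s) c = FlagOrbit.gammaEntry (ρ := 2) s c := by
  have ind_eq : ∀ (p : Prop) [Decidable p], ind p = if p then 1 else 0 := fun p _ => (ind_spec p).1
  rcases c with t | ⟨s', i⟩ | ⟨j, t⟩
  · rfl
  · simp only [entry, FlagOrbit.gammaEntry, ind_eq]
  · rfl

/-- T-line rows vanish on the `Z`-columns. -/
theorem entry_tline_z (kt : Fin 6 × Fin 4) (t : Fin 2) : D.entry (Sum.inr (Sum.inr kt)) (Sum.inl t) = 0 := by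
  obtain ⟨k, t'⟩ := kt; rfl

/-- The side diagonal is `2` (uses `ψ s i ≠ i`). -/
theorem entry_side_diag (hψ : ∀ s i, D.ψ s i ≠ i) (x : Fin 2 × Fin 12) : D.entry (Sum.inr (Sum.inl x)) (Sum.inr (Sum.inl x)) = 2 := by
  obtain ⟨s, i⟩ := x
  have ind_eq : ∀ (p : Prop) [Decidable p], ind p = if p then 1 else 0 := fun p _ => (ind_spec p).1
  have h1 : ind (i = D.ψ s i) = 0 := by rw [ind_eq]; exact if_neg (fun e => hψ s i e.symm)
  have h2 : ind (i = i) = 1 := by rw [ind_eq]; exact if_pos rfl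
  show (if s = s then 2 * ind (i = i) + ind (i = D.ψ s i) else ind (i ∈ D.R s i)) = 2
  rw [if_pos rfl, h1, h2]

/-- Off the side diagonal every entry is `0/1`. -/
theorem entry_le_one {r : F7Row} {c : F7Col} (hrc : ∀ x : Fin 2 × Fin 12, ¬ (r = Sum.inr (Sum.inl x) ∧ c = Sum.inr (Sum.inl x))) :
    D.entry r c ≤ 1 := by
  have ind_eq : ∀ (p : Prop) [Decidable p], ind p = if p then 1 else 0 := fun p _ => (ind_spec p).1
  have ind_le_one : ∀ (p : Prop), ind p ≤ 1 := fun p => (ind_spec p).2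
  rcases r with s | ⟨s, i⟩ | ⟨k, t⟩ <;> rcases c with t' | ⟨s', i'⟩ | ⟨j, t'⟩ <;> simp only [entry] <;> try exact ind_le_one _
  · exact Nat.zero_le _
  · exact Nat.zero_le _
  · by_cases hss : s' = s
    · subst hss
      rw [if_pos rfl]
      have hii : i' ≠ i := fun e => hrc (s', i') ⟨by rw [e], rfl⟩
      have h0 : ind (i' = i) = 0 := by rw [ind_eq]; exact if_neg hii
      rw [h0, mul_zero, zero_add]; exact ind_le_one _
    · rw [if_neg hss]; exact ind_le_one _
  · exact Nat.zero_le _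

/-- Off the side diagonal `e·e = e`; on it `2·2 = 2 + 2`. As a uniform statement: `e·e = e + 2·[diagonal side entry]`. -/
theorem entry_mul_self (hψ : ∀ s i, D.ψ s i ≠ i) (r : F7Row) (c : F7Col) :
    D.entry r c * D.entry r c = D.entry r c + (if ∃ x : Fin 2 × Fin 12, r = Sum.inr (Sum.inl x) ∧ c = Sum.inr (Sum.inl x) then 2 else 0) := by
  by_cases hx : ∃ x : Fin 2 × Fin 12, r = Sum.inr (Sum.inl x) ∧ c = Sum.inr (Sum.inl x)
  · obtain ⟨x, rfl, rfl⟩ := hx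
    rw [D.entry_side_diag hψ x, if_pos ⟨x, rfl, rfl⟩]
  · rw [if_neg hx, add_zero]
    have h1 := D.entry_le_one (r := r) (c := c) (fun x hh => hx ⟨x, hh⟩)
    rcases Nat.le_one_iff_eq_zero_or_eq_one.1 h1 with h | h <;> simp [h]

/-! ### Totals -/

/-- **Row totals** of the structured matrix: `12 / 13 / 12`. -/
theorem entry_rowSum (h : IsFlagSevenOrbitMatrix D) (r : F7Row) : ∑ c : F7Col, D.entry r c = FlagOrbit.rowSum (ρ := 2) r := by
  obtain ⟨hψ, hR, hC, hCu, hβ, hrows, hcols⟩ := h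
  have ind_eq : ∀ (p : Prop) [Decidable p], ind p = if p then 1 else 0 := fun p _ => (ind_spec p).1
  rcases r with s | ⟨s, i⟩ | ⟨k, t⟩
  · -- Γ_s : twelve 1's on the triangles of class s
    rw [Fintype.sum_sum_type, Fintype.sum_sum_type, Fintype.sum_prod_type]
    have h0 : ∑ t : Fin 2, D.entry (Sum.inl s) (Sum.inl t) = 0 := Finset.sum_eq_zero fun t _ => rfl
    have h2 : ∑ jt : Fin 6 × Fin 4, D.entry (Sum.inl s) (Sum.inr (Sum.inr jt)) = 0 := Finset.sum_eq_zero fun ⟨j, t⟩ _ => rfl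
    have h1 : ∀ s' : Fin 2, ∑ i : Fin 12, D.entry (Sum.inl s) (Sum.inr (Sum.inl (s', i))) = if s' = s then 12 else 0 := by
      intro s'
      simp only [entry, ind_eq, Finset.sum_const, Finset.card_univ, Fintype.card_fin, smul_eq_mul]
      split_ifs <;> simp
    rw [h0, h2, Finset.sum_congr rfl (fun s' _ => h1 s'), Finset.sum_ite_eq' univ s, if_pos (mem_univ _)]
    rfl
  · -- side (s,i): 1 (Z) + 3 (own class: 2 + ψ) + 3 (other class: R) + 6 (one per m_j)
    rw [Fintype.sum_sum_type, Fintype.sum_sum_type, Fintype.sum_prod_type]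
    have hZ : ∑ t : Fin 2, D.entry (Sum.inr (Sum.inl (s, i))) (Sum.inl t) = 1 := by
      simp only [entry, ind_eq, Finset.sum_ite_eq, mem_univ, if_true]
    have hcls : ∀ s' : Fin 2, ∑ i' : Fin 12, D.entry (Sum.inr (Sum.inl (s, i))) (Sum.inr (Sum.inl (s', i'))) = 3 := by
      intro s'
      by_cases hss : s' = s
      · subst hss
        simp only [entry, Finset.sum_add_distrib, ind_eq, ← Finset.mul_sum, Finset.sum_ite_eq', mem_univ, if_true]
        norm_num
      · simp only [entry, if_neg hss, ind_eq, Finset.sum_boole, Nat.cast_id]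
        rw [show (univ.filter fun i' : Fin 12 => i' ∈ D.R s i) = D.R s i by ext i'; simp]
        exact hR s i
    have hT : ∑ jt : Fin 6 × Fin 4, D.entry (Sum.inr (Sum.inl (s, i))) (Sum.inr (Sum.inr jt)) = 6 := by
      rw [Fintype.sum_prod_type]
      simp only [entry, ind_eq, Finset.sum_ite_eq, mem_univ, if_true, Finset.sum_const, Finset.card_univ, Fintype.card_fin,
        smul_eq_mul, mul_one]
    rw [hZ, Finset.sum_congr rfl (fun s' _ => hcls s'), hT]
    simp [FlagOrbit.rowSum]
  · -- T-line (k,t): 0 (Z) + Σ_s |C k t s| = 6 + 6 (one per m_j)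
    rw [Fintype.sum_sum_type, Fintype.sum_sum_type, Fintype.sum_prod_type]
    have hZ : ∑ t' : Fin 2, D.entry (Sum.inr (Sum.inr (k, t))) (Sum.inl t') = 0 := Finset.sum_eq_zero fun t' _ => rfl
    have hcls : ∀ s : Fin 2, ∑ i : Fin 12, D.entry (Sum.inr (Sum.inr (k, t))) (Sum.inr (Sum.inl (s, i))) = 3 := by
      intro s
      simp only [entry, ind_eq, Finset.sum_boole, Nat.cast_id]
      rw [show (univ.filter fun i : Fin 12 => i ∈ D.C k t s) = D.C k t s by ext i; simp]
      exact hC k t s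
    have hT : ∑ jt : Fin 6 × Fin 4, D.entry (Sum.inr (Sum.inr (k, t))) (Sum.inr (Sum.inr jt)) = 6 := by
      rw [Fintype.sum_prod_type]
      simp only [entry, ind_eq, Finset.sum_ite_eq, mem_univ, if_true, Finset.sum_const, Finset.card_univ, Fintype.card_fin,
        smul_eq_mul, mul_one]
    rw [hZ, Finset.sum_congr rfl (fun s _ => hcls s), hT]
    simp [FlagOrbit.rowSum]

/-- **Column totals** of the structured matrix, from the column norms: `Σ_r e = Σ_r e·e − 2·[triangle column] = 12 / 13 / 12`. -/
theorem entry_colSum (h : IsFlagSevenOrbitMatrix D) (c : F7Col) : ∑ r : F7Row, D.entry r c = FlagOrbit.colSum (ρ := 2) c := by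
  have hψ := h.1
  have hnorm := h.2.2.2.2.2.2 c c
  rw [Finset.sum_congr rfl (fun r _ => D.entry_mul_self hψ r c), Finset.sum_add_distrib] at hnorm
  rcases c with t | x | ⟨j, t⟩
  · have h0 : ∑ r : F7Row, (if ∃ x : Fin 2 × Fin 12, r = Sum.inr (Sum.inl x) ∧ (Sum.inl t : F7Col) = Sum.inr (Sum.inl x) then 2 else 0) = 0 :=
      Finset.sum_eq_zero fun r _ => if_neg (by rintro ⟨x, -, hx⟩; cases hx)
    rw [h0, add_zero] at hnorm
    simpa [colTarget, FlagOrbit.colSum] using hnorm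
  · have h2 : ∑ r : F7Row, (if ∃ x' : Fin 2 × Fin 12, r = Sum.inr (Sum.inl x') ∧ (Sum.inr (Sum.inl x) : F7Col) = Sum.inr (Sum.inl x') then 2 else 0) = 2 := by
      rw [Finset.sum_eq_single (Sum.inr (Sum.inl x))]
      · rw [if_pos ⟨x, rfl, rfl⟩]
      · intro r _ hr
        refine if_neg ?_
        rintro ⟨x', rfl, hx⟩
        simp only [Sum.inr.injEq, Sum.inl.injEq] at hx
        exact hr (by rw [hx])
      · intro hh; exact absurd (mem_univ _) hh
    have ht : colTarget (Sum.inr (Sum.inl x)) (Sum.inr (Sum.inl x)) = 15 := by simp [colTarget]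
    rw [h2, ht] at hnorm
    show ∑ r : F7Row, D.entry r (Sum.inr (Sum.inl x)) = 13
    omega
  · have h0 : ∑ r : F7Row, (if ∃ x : Fin 2 × Fin 12, r = Sum.inr (Sum.inl x) ∧ (Sum.inr (Sum.inr (j, t)) : F7Col) = Sum.inr (Sum.inl x) then 2 else 0) = 0 :=
      Finset.sum_eq_zero fun r _ => if_neg (by rintro ⟨x, -, hx⟩; cases hx)
    rw [h0, add_zero] at hnorm
    simpa [colTarget, FlagOrbit.colSum] using hnorm

end FlagSevenOrbitData

/-- **A structured `f = 7` orbit matrix is a plain orbit matrix with `ρ = 2`.** -/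
theorem isFlagOrbitMatrix_of_isFlagSevenOrbitMatrix {D : FlagSevenOrbitData} (h : IsFlagSevenOrbitMatrix D) :
    IsFlagOrbitMatrix 2 D.entry := by
  refine ⟨fun r => D.entry_rowSum h r, fun c => D.entry_colSum h c, fun r r' => ?_, fun c c' => ?_,
    fun s c => D.entry_gamma s c, fun kt t => D.entry_tline_z kt t, fun x => D.entry_side_diag h.1 x⟩
  · rw [← FlagSevenOrbitData.rowTarget_eq]; exact h.2.2.2.2.2.1 r r'
  · rw [← FlagSevenOrbitData.colTarget_eq]; exact h.2.2.2.2.2.2 c c'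

/-- **The plain statement for `ρ = 2` implies the structured one:** `NoFlagOrbitMatrix 2 → NoFlagSevenOrbitMatrix`. -/
theorem noFlagSevenOrbitMatrix_of_noFlagOrbitMatrix_two (h2 : NoFlagOrbitMatrix 2) : NoFlagSevenOrbitMatrix :=
  fun _ hD => h2 _ (isFlagOrbitMatrix_of_isFlagSevenOrbitMatrix hD)

end Summit.Ventures.DiscreteObjects.PP12
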